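import Summits.CriticalPhenomena.CardyFormulaZ2.Theorems.CardyIKTransportIKLinearTransportStubCutMarkovKernelComb

/-!
# Stub `stub_CutMarkovKernel` (K) — part D: the CUT-ADAPTED GAUGE of the coded bits

Support file (`--supports stmt-CriticalPhenomena-5076`, registered sub-goal `cmk_nuMix_eq_map_Xi`).

The a-priori structure of the middle column of `νmix T` (face columns `i, i+1` of different type,
`τ = [i ∈ T]`): in the coded gauge `SDE.PJ` (product Bernoulli bits, `…SDEPlumb2.lean`) we apply the
`PJ`-preserving involution `cmkΨ i τ c` (`cmk_skew_map_eq`: a fair coordinate xored with a function of OTHER,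
untouched, coordinates keeps the product law — proved once, abstractly, by gluing two independent samples)
which (1) xors the fair plaquette of the honeycomb face column with the biased plaquette of the isotropic one,
(2) re-anchors the column bit of cell column `i+1` at the row `c` (xor with the parity of the isotropic
plaquettes of the rows `[c, 0)`), and (3) absorbs the column bit of cell column `i` into the row bits and the
column bits of columns `i+1, i+2`. After it (`cmkΞ i T c := ObsJ ∘ cmkΨ`, `cmk_nuMix_eq_map_Xi`:
`νmix T = PJ.map (cmkΞ i T c)`) the strip reads (`cmk_mem_Xi_col0/1/2`, `cmk_mem_Xi2_col0/1`):
`ξ_y = r_y`, `ζ_y = κ₂ ⊕ r_y ⊕ Π^F_{0→y}`, `η_y = κ₁ ⊕ r_y ⊕ [¬τ] Π^F_{0→y} ⊕ Π^B_{c→y}`, iso flags = coins,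
hc flags forced — the middle colour is the iso-side boundary colour xor a two-state chain driven by the
biased plaquettes `B`, ANCHORED AT THE CUT ROW `c`, so that the rows below `c` and the rows above `c` read
disjoint sets of noise bits.
-/

noncomputable section

namespace Summit.CriticalPhenomena.CardyFormulaZ2.Theorems.IKLinearTransport.PinnedDiagramExchange

open scoped Classical MeasureTheory ENNReal ProbabilityTheory symmDiff
open Set MeasureTheory
open Literature.Probability.Percolation Literature.Probability.LatticeModels

/-! ## Coordinates of the coded gauge -/

/-- Column bit of cell column `x`. [folklore] -/
def jCB (x : ℤ) : SDE.JIdx := Sum.inl x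
/-- Row bit of row `y`. [folklore] -/
def jRB (y : ℤ) : SDE.JIdx := Sum.inr (Sum.inl y)
/-- Biased plaquette of the face `f`. [folklore] -/
def jBP (f : Site 2) : SDE.JIdx := Sum.inr (Sum.inr (Sum.inl f))
/-- Fair plaquette of the face `f`. [folklore] -/
def jFP (f : Site 2) : SDE.JIdx := Sum.inr (Sum.inr (Sum.inr (Sum.inl f)))
/-- Diagonal coin of the face `f`. [folklore] -/
def jCO (f : Site 2) : SDE.JIdx := Sum.inr (Sum.inr (Sum.inr (Sum.inr f)))

/-! ## The abstract skew lemma -/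

/-- Flipping the coordinates marked by `t`. [folklore] -/
def cmkFlip (t : SDE.JIdx → Bool) (g : SDE.KJ) : SDE.KJ := fun j => g j ^^ t j

/-- The fair Bernoulli law on `Bool` is invariant under negation. [folklore] -/
theorem cmk_ber_half_map_not : (Ber(true, false, half) : Measure Bool).map (fun b => !b) = Ber(true, false, half) := by
  rw [ProbabilityTheory.map_bernoulliMeasure' _ _ (measurable_of_countable _)]
  have hσ : unitInterval.symm half = half := Subtype.ext (by simp [half]; norm_num)
  simp only [Bool.not_true, Bool.not_false, ProbabilityTheory.bernoulliMeasure_def, hσ]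
  rw [add_comm]

/-- FLIPPING FAIR COORDINATES preserves the coded product law. [folklore] -/
theorem cmk_flip_map_eq (t : SDE.JIdx → Bool) (ht : ∀ j, t j = true → SDE.wJ j = half) :
    SDE.PJ.map (cmkFlip t) = SDE.PJ := by
  unfold SDE.PJ cmkFlip
  rw [show (fun g : SDE.KJ => fun j => g j ^^ t j) = fun g j => (fun j b => b ^^ t j) j (g j) from rfl,
    Measure.infinitePi_map_pi (μ := fun j => (Ber(true, false, SDE.wJ j) : Measure Bool)) (f := fun j b => b ^^ t j)
      (fun j => measurable_of_countable _)]
  congr 1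
  funext j
  cases htj : t j
  · have : (fun b : Bool => b ^^ false) = id := funext fun b => Bool.xor_false b
    rw [this, Measure.map_id]
  · have : (fun b : Bool => b ^^ true) = fun b => !b := funext fun b => Bool.xor_true b
    rw [this, ht j htj, cmk_ber_half_map_not]

/-- THE SKEW LEMMA: xoring coordinates with a correction that reads only a set `Dr` of untouched ("driver")
coordinates and flips fair coordinates only, preserves the coded product law. [folklore] -/
theorem cmk_skew_map_eq (Dr : Set SDE.JIdx) (corr : SDE.KJ → SDE.JIdx → Bool)
    (hdep : ∀ g g' : SDE.KJ, (∀ j ∈ Dr, g j = g' j) → corr g = corr g')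
    (hDr : ∀ g, ∀ j ∈ Dr, corr g j = false) (hfair : ∀ g j, corr g j = true → SDE.wJ j = half)
    (hmeas : ∀ j, Measurable fun g => corr g j) :
    SDE.PJ.map (fun g j => g j ^^ corr g j) = SDE.PJ := by
  set Ψ : SDE.KJ → SDE.KJ := fun g j => g j ^^ corr g j with hΨ
  set G : SDE.KJ × SDE.KJ → SDE.KJ := fun p => SDE.glue Drᶜ p.1 p.2 with hG
  set Sk : SDE.KJ × SDE.KJ → SDE.KJ × SDE.KJ := fun p => (p.1, cmkFlip (corr p.1) p.2) with hSk
  have hΨm : Measurable Ψ := measurable_pi_lambda _ fun j =>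
    (measurable_of_countable fun bb : Bool × Bool => bb.1 ^^ bb.2).comp ((measurable_pi_apply j).prodMk (hmeas j))
  have hGm : Measurable G := by
    refine measurable_pi_lambda _ fun j => ?_
    by_cases hj : j ∈ Drᶜ
    · simp only [hG, SDE.glue, hj, if_true]; fun_prop
    · simp only [hG, SDE.glue, hj, if_false]; fun_prop
  have hglue : (SDE.PJ.prod SDE.PJ).map G = SDE.PJ := by unfold SDE.PJ; exact SDE.infinitePi_glue _ _
  -- `Ψ ∘ G = G ∘ Sk`
  have hcomm : Ψ ∘ G = G ∘ Sk := by
    funext p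
    have hc : corr (SDE.glue Drᶜ p.1 p.2) = corr p.1 := hdep _ _ fun j hj => by simp [SDE.glue, hj]
    funext j
    simp only [Function.comp_apply, hΨ, hSk, hG, hc, SDE.glue, cmkFlip, mem_compl_iff]
    by_cases hj : j ∈ Dr
    · simp [hj, hDr p.1 j hj]
    · simp [hj]
  -- `Sk` preserves `PJ ⊗ PJ`
  have hSkm : Measurable (Function.uncurry fun (a : SDE.KJ) (b : SDE.KJ) => cmkFlip (corr a) b) := by
    refine measurable_pi_lambda _ fun j => ?_
    have h2 : Measurable fun p : SDE.KJ × SDE.KJ => (p.2 j, corr p.1 j) :=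
      ((measurable_pi_apply j).comp measurable_snd).prodMk ((hmeas j).comp measurable_fst)
    exact (measurable_of_countable fun bb : Bool × Bool => bb.1 ^^ bb.2).comp h2
  have hSk_pres : MeasurePreserving Sk (SDE.PJ.prod SDE.PJ) (SDE.PJ.prod SDE.PJ) :=
    (MeasurePreserving.id SDE.PJ).skew_product hSkm (Filter.Eventually.of_forall fun a => cmk_flip_map_eq _ (hfair a))
  calc SDE.PJ.map Ψ = ((SDE.PJ.prod SDE.PJ).map G).map Ψ := by rw [hglue]
    _ = (SDE.PJ.prod SDE.PJ).map (Ψ ∘ G) := Measure.map_map hΨm hGm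
    _ = ((SDE.PJ.prod SDE.PJ).map Sk).map G := by rw [hcomm, Measure.map_map hGm hSk_pres.measurable]
    _ = SDE.PJ := by rw [hSk_pres.map_eq, hglue]

/-! ## The cut-adapted skew -/

/-- Biased plaquettes of the isotropic face column. [folklore] -/
def cmkB (i : ℤ) (τ : Bool) (g : SDE.KJ) (s : ℤ) : Bool := g (jBP ![SDE.isoC i τ, s])

/-- Fair plaquettes of the honeycomb face column. [folklore] -/
def cmkF (i : ℤ) (τ : Bool) (g : SDE.KJ) (s : ℤ) : Bool := g (jFP ![SDE.hcC i τ, s])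

/-- The correction of the cut-adapted skew. [folklore] -/
def cmkCorr (i : ℤ) (τ : Bool) (c : ℤ) (g : SDE.KJ) : SDE.JIdx → Bool
  | Sum.inl x => (decide (x = i + 1 ∨ x = i + 2) && g (jCB i)) ^^ (decide (x = i + 1) && SDE.bp (cmkB i τ g) c 0)
  | Sum.inr (Sum.inl _) => g (jCB i)
  | Sum.inr (Sum.inr (Sum.inl _)) => false
  | Sum.inr (Sum.inr (Sum.inr (Sum.inl f))) => decide (f 0 = SDE.hcC i τ) && g (jBP ![SDE.isoC i τ, f 1])
  | Sum.inr (Sum.inr (Sum.inr (Sum.inr _))) => false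

/-- THE CUT-ADAPTED SKEW of the coded gauge. [folklore] -/
def cmkΨ (i : ℤ) (τ : Bool) (c : ℤ) (g : SDE.KJ) : SDE.KJ := fun j => g j ^^ cmkCorr i τ c g j

/-- The drivers of the skew: the column bit of column `i` and all biased plaquettes. [folklore] -/
def cmkDr (i : ℤ) : Set SDE.JIdx := {j | j = jCB i ∨ ∃ f, j = jBP f}

/-- Boolean statistics of a product of bits reading finitely many of them are measurable. [folklore] -/
theorem cmk_measurable_of_det {ι : Type*} (f : (ι → Bool) → Bool) (J : Finset ι)
    (h : ∀ b b' : ι → Bool, (∀ j ∈ J, b j = b' j) → f b = f b') : Measurable f := by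
  refine measurable_to_countable' fun t => ?_
  set E : Set (ι → Bool) := f ⁻¹' {t} with hEdef
  have hE : E = (fun (b : ι → Bool) (j : ↥J) => b j) ⁻¹' ((fun (b : ι → Bool) (j : ↥J) => b j) '' E) := by
    ext b
    constructor
    · intro hb; exact ⟨b, hb, rfl⟩
    · rintro ⟨b', hb', he⟩
      have : f b' = f b := h b' b fun j hj => congrFun he ⟨j, hj⟩
      simp only [hEdef, mem_preimage, mem_singleton_iff] at hb' ⊢
      rw [← this]; exact hb'
  rw [hE]
  exact (Set.toFinite ((fun (b : ι → Bool) (j : ↥J) => b j) '' E)).measurableSet.preimage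
    (measurable_pi_lambda _ fun j => measurable_pi_apply (j : ι))

/-- `SDE.bp f u v` reads `f` on `[min u v, max u v)` only. [folklore] -/
theorem cmk_bp_congr' {f g : ℤ → Bool} {u v : ℤ} (h : ∀ s ∈ Finset.Ico (min u v) (max u v), f s = g s) :
    SDE.bp f u v = SDE.bp g u v :=
  SDE.bp_congr fun s h1 h2 => h s (Finset.mem_Ico.2 ⟨h1, h2⟩)

/-- The correction is measurable. [folklore] -/
theorem cmk_measurable_corr (i : ℤ) (τ : Bool) (c : ℤ) (j : SDE.JIdx) : Measurable fun g => cmkCorr i τ c g j := by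
  rcases j with x | y | f | f | f
  · refine cmk_measurable_of_det _ (insert (jCB i) ((Finset.Ico (min c 0) (max c 0)).image fun s => jBP ![SDE.isoC i τ, s]))
      fun b b' hb => ?_
    have h1 : b (jCB i) = b' (jCB i) := hb _ (Finset.mem_insert_self _ _)
    have h2 : SDE.bp (cmkB i τ b) c 0 = SDE.bp (cmkB i τ b') c 0 := cmk_bp_congr' fun s hs =>
      hb _ (Finset.mem_insert_of_mem (Finset.mem_image_of_mem _ hs))
    simp only [cmkCorr, h1, h2]
  · exact cmk_measurable_of_det _ {jCB i} fun b b' hb => by simp only [cmkCorr, hb _ (Finset.mem_singleton_self _)]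
  · exact measurable_const
  · exact cmk_measurable_of_det _ {jBP ![SDE.isoC i τ, f 1]} fun b b' hb => by
      simp only [cmkCorr, hb _ (Finset.mem_singleton_self _)]
  · exact measurable_const

/-- `cmkΨ` is measurable. [folklore] -/
theorem cmk_measurable_Ψ (i : ℤ) (τ : Bool) (c : ℤ) : Measurable (cmkΨ i τ c) :=
  measurable_pi_lambda _ fun j => (measurable_of_countable fun bb : Bool × Bool => bb.1 ^^ bb.2).comp
    ((measurable_pi_apply j).prodMk (cmk_measurable_corr i τ c j))

/-- THE CUT-ADAPTED SKEW PRESERVES THE CODED LAW. [folklore] -/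
theorem cmk_PJ_map_Ψ (i : ℤ) (τ : Bool) (c : ℤ) : SDE.PJ.map (cmkΨ i τ c) = SDE.PJ := by
  refine cmk_skew_map_eq (cmkDr i) (cmkCorr i τ c) (fun g g' h => ?_) (fun g j hj => ?_) (fun g j hj => ?_)
    (cmk_measurable_corr i τ c)
  · have h1 : g (jCB i) = g' (jCB i) := h _ (Or.inl rfl)
    have h2 : ∀ f, g (jBP f) = g' (jBP f) := fun f => h _ (Or.inr ⟨f, rfl⟩)
    have h3 : SDE.bp (cmkB i τ g) c 0 = SDE.bp (cmkB i τ g') c 0 := cmk_bp_congr' fun s _ => h2 _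
    funext j
    rcases j with x | y | f | f | f <;> simp only [cmkCorr, h1, h2, h3]
  · rcases hj with rfl | ⟨f, rfl⟩
    · have d1 : decide (i = i + 1 ∨ i = i + 2) = false := decide_eq_false (by omega)
      have d2 : decide (i = i + 1) = false := decide_eq_false (by omega)
      show ((decide (i = i + 1 ∨ i = i + 2) && g (jCB i)) ^^ (decide (i = i + 1) && SDE.bp (cmkB i τ g) c 0)) = false
      rw [d1, d2]; rfl
    · rfl
  · rcases j with x | y | f | f | f
    · rfl
    · rfl
    · simp [cmkCorr] at hj
    · rfl
    · simp [cmkCorr] at hj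

/-! ## The cut-adapted observables and their law -/

/-- THE CUT-ADAPTED OBSERVABLE MAP: the coded observables after the skew. [folklore] -/
def cmkΞ (i : ℤ) (T : Set ℤ) (c : ℤ) (g : SDE.KJ) : Obs := SDE.ObsJ i T (cmkΨ i (decide (i ∈ T)) c g)

/-- `cmkΞ` is measurable. [folklore] -/
theorem cmk_measurable_Ξ (i : ℤ) (T : Set ℤ) (c : ℤ) : Measurable (cmkΞ i T c) :=
  (SDE.measurable_ObsJ i T).comp (cmk_measurable_Ψ i _ c)

/-- THE LAW OF THE OBSERVABLES THROUGH THE CUT-ADAPTED GAUGE (registered sub-goal `cmk_nuMix_eq_map_Xi`):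
`νmix T = PJ.map (cmkΞ i T c)`. [folklore] -/
theorem cmk_nuMix_eq_map_Xi : ∀ (i : ℤ) (T : Set ℤ) (c : ℤ), νmix T = SDE.PJ.map (cmkΞ i T c) := by
  intro i T c
  have e : cmkΞ i T c = SDE.ObsJ i T ∘ cmkΨ i (decide (i ∈ T)) c := rfl
  rw [SDE.nuMix_eq_map_ObsJ T i (SDE.measurable_ObsJ i T), e,
    ← Measure.map_map (SDE.measurable_ObsJ i T) (cmk_measurable_Ψ i _ c), cmk_PJ_map_Ψ]

/-! ## Reading the strip in the cut-adapted gauge -/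

/-- Left boundary colour `ξ_y` (the row bit). [folklore] -/
def cmkXi (g : SDE.KJ) (y : ℤ) : Bool := g (jRB y)

/-- Right boundary colour `ζ_y = κ₂ ⊕ r_y ⊕ Π^F_{0 → y}`. [folklore] -/
def cmkZe (i : ℤ) (τ : Bool) (g : SDE.KJ) (y : ℤ) : Bool := g (jCB (i + 2)) ^^ g (jRB y) ^^ SDE.bp (cmkF i τ g) 0 y

/-- Middle colour `η_y = κ₁ ⊕ r_y ⊕ [¬τ] Π^F_{0 → y} ⊕ Π^B_{c → y}` (chain anchored at the cut row). [folklore] -/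
def cmkMi (i : ℤ) (τ : Bool) (c : ℤ) (g : SDE.KJ) (y : ℤ) : Bool :=
  g (jCB (i + 1)) ^^ g (jRB y) ^^ (!τ && SDE.bp (cmkF i τ g) 0 y) ^^ SDE.bp (cmkB i τ g) c y

/-- Flag coin of the isotropic face column. [folklore] -/
def cmkTi (i : ℤ) (τ : Bool) (g : SDE.KJ) (y : ℤ) : Bool := g (jCO ![SDE.isoC i τ, y])

/-- `bp` of a pointwise xor. [folklore] -/
theorem cmk_bp_xor (f g : ℤ → Bool) (u v : ℤ) : SDE.bp (fun s => f s ^^ g s) u v = (SDE.bp f u v ^^ SDE.bp g u v) := by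
  unfold SDE.bp
  have hz : ∀ a b : Bool, SDE.bz (a ^^ b) = SDE.bz a + SDE.bz b := by decide
  simp only [hz, Finset.sum_add_distrib]
  have fin : ∀ a b : ZMod 2, decide (a + b = 1) = (decide (a = 1) ^^ decide (b = 1)) := by decide
  rw [fin]

section Reading

variable (i : ℤ) (T : Set ℤ) (c : ℤ)

/-- The core bits of the skewed configuration. [folklore] -/
theorem cmk_coreOf_Ψ (τ : Bool) (g : SDE.KJ) (y : ℤ) :
    SDE.coreOf i τ (cmkΨ i τ c g) (0, y) = (g (jRB y) ^^ g (jCB i)) ∧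
    SDE.coreOf i τ (cmkΨ i τ c g) (1, y) = cmkB i τ g y ∧
    SDE.coreOf i τ (cmkΨ i τ c g) (2, y) = cmkTi i τ g y ∧
    SDE.coreOf i τ (cmkΨ i τ c g) (3, y) = (cmkF i τ g y ^^ cmkB i τ g y) ∧
    SDE.coreOf i τ (cmkΨ i τ c g) (4, 1) = (g (jCB (i + 1)) ^^ g (jCB i) ^^ SDE.bp (cmkB i τ g) c 0) ∧
    cmkΨ i τ c g (Sum.inl i) = g (jCB i) ∧ cmkΨ i τ c g (Sum.inl (i + 2)) = (g (jCB (i + 2)) ^^ g (jCB i)) := by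
  obtain ⟨e0, e1, e2, e3, -⟩ := SDE.ιc_apply i τ y
  obtain ⟨-, -, -, -, e4⟩ := SDE.ιc_apply i τ 1
  have d1 : decide (i = i + 1 ∨ i = i + 2) = false := decide_eq_false (by omega)
  have d2 : decide (i = i + 1) = false := decide_eq_false (by omega)
  have d3 : decide (i + 2 = i + 1 ∨ i + 2 = i + 2) = true := decide_eq_true (Or.inr rfl)
  have d4 : decide (i + 2 = i + 1) = false := decide_eq_false (by omega)
  have d5 : decide (i + 1 = i + 1 ∨ i + 1 = i + 2) = true := decide_eq_true (Or.inl rfl)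
  have d6 : decide (i + 1 = i + 1) = true := decide_eq_true rfl
  have d7 : decide ((![SDE.hcC i τ, y] : Site 2) 0 = SDE.hcC i τ) = true := decide_eq_true (by simp)
  have d8 : ((![SDE.hcC i τ, y] : Site 2) 1) = y := by simp
  refine ⟨?_, ?_, ?_, ?_, ?_, ?_, ?_⟩
  · simp only [SDE.coreOf, e0, cmkΨ, cmkCorr, jRB, jCB]
  · simp only [SDE.coreOf, e1, cmkΨ, cmkCorr, cmkB, jBP, Bool.xor_false]
  · simp only [SDE.coreOf, e2, cmkΨ, cmkCorr, cmkTi, jCO, Bool.xor_false]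
  · simp only [SDE.coreOf, e3, cmkΨ, cmkCorr, cmkF, cmkB, jFP, jBP, d7, d8, Bool.true_and]
  · rw [SDE.coreOf, e4]
    show (g (jCB (i + 1)) ^^ ((decide (i + 1 = i + 1 ∨ i + 1 = i + 2) && g (jCB i)) ^^
      (decide (i + 1 = i + 1) && SDE.bp (cmkB i τ g) c 0))) = (g (jCB (i + 1)) ^^ g (jCB i) ^^ SDE.bp (cmkB i τ g) c 0)
    rw [d5, d6]
    cases g (jCB (i + 1)) <;> cases g (jCB i) <;> cases SDE.bp (cmkB i τ g) c 0 <;> rfl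
  · show (g (jCB i) ^^ ((decide (i = i + 1 ∨ i = i + 2) && g (jCB i)) ^^ (decide (i = i + 1) && SDE.bp (cmkB i τ g) c 0))) =
      g (jCB i)
    rw [d1, d2]
    cases g (jCB i) <;> rfl
  · show (g (jCB (i + 2)) ^^ ((decide (i + 2 = i + 1 ∨ i + 2 = i + 2) && g (jCB i)) ^^
      (decide (i + 2 = i + 1) && SDE.bp (cmkB i τ g) c 0))) = (g (jCB (i + 2)) ^^ g (jCB i))
    rw [d3, d4]
    cases g (jCB (i + 2)) <;> cases g (jCB i) <;> rfl

variable {T}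

/-- STRIP COLOURS, column `i`: `ξ_y = r_y`. [folklore] -/
theorem cmk_mem_Xi_col0 {τ : Bool} (hτ : decide (i ∈ T) = τ) (g : SDE.KJ) (v : Site 2) (hv : v 0 = i) :
    v ∈ (cmkΞ i T c g).1 ↔ cmkXi g (v 1) = true := by
  obtain ⟨e0, -, -, -, -, ei, -⟩ := cmk_coreOf_Ψ i c τ g (v 1)
  rw [cmkΞ, SDE.memObsJ_col0 i T (decide (i ∈ T)) _ v hv, hτ, SDE.col_zero, ei, e0, cmkXi]
  cases g (jRB (v 1)) <;> cases g (jCB i) <;> simp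

/-- STRIP COLOURS, column `i+2`: `ζ_y`. [folklore] -/
theorem cmk_mem_Xi_col2 (hT : i ∈ T ↔ i + 1 ∉ T) {τ : Bool} (hτ : decide (i ∈ T) = τ) (g : SDE.KJ) (v : Site 2)
    (hv : v 0 = i + 2) : v ∈ (cmkΞ i T c g).1 ↔ cmkZe i τ g (v 1) = true := by
  obtain ⟨e0, -, -, -, -, -, ei2⟩ := cmk_coreOf_Ψ i c τ g (v 1)
  have e1 : (fun s => SDE.coreOf i τ (cmkΨ i τ c g) (1, s)) = cmkB i τ g := funext fun s => (cmk_coreOf_Ψ i c τ g s).2.1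
  have e3 : (fun s => SDE.coreOf i τ (cmkΨ i τ c g) (3, s)) = fun s => cmkF i τ g s ^^ cmkB i τ g s :=
    funext fun s => (cmk_coreOf_Ψ i c τ g s).2.2.2.1
  rw [cmkΞ, SDE.memObsJ_col2 i T hT _ v hv, hτ, SDE.col_two, ei2, e0, e1, e3, cmk_bp_xor, cmkZe]
  cases g (jRB (v 1)) <;> cases g (jCB i) <;> cases g (jCB (i + 2)) <;> cases SDE.bp (cmkB i τ g) 0 (v 1) <;>
    cases SDE.bp (cmkF i τ g) 0 (v 1) <;> simp

/-- STRIP COLOURS, column `i+1`: `η_y`, the chain anchored at the cut row `c`. [folklore] -/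
theorem cmk_mem_Xi_col1 {τ : Bool} (hτ : decide (i ∈ T) = τ) (g : SDE.KJ) (v : Site 2) (hv : v 0 = i + 1) :
    v ∈ (cmkΞ i T c g).1 ↔ cmkMi i τ c g (v 1) = true := by
  obtain ⟨e0, -, -, -, e4, -, -⟩ := cmk_coreOf_Ψ i c τ g (v 1)
  have e1 : (fun s => SDE.coreOf i τ (cmkΨ i τ c g) (1, s)) = cmkB i τ g := funext fun s => (cmk_coreOf_Ψ i c τ g s).2.1
  have e3 : (fun s => SDE.coreOf i τ (cmkΨ i τ c g) (3, s)) = fun s => cmkF i τ g s ^^ cmkB i τ g s :=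
    funext fun s => (cmk_coreOf_Ψ i c τ g s).2.2.2.1
  have hch : SDE.bp (cmkB i τ g) c (v 1) = (SDE.bp (cmkB i τ g) c 0 ^^ SDE.bp (cmkB i τ g) 0 (v 1)) := SDE.bp_chasles _ _ _ _
  rw [cmkΞ, SDE.memObsJ_col1 i T _ v hv, hτ, SDE.col_one, e0, e4, cmkMi, hch]
  cases τ
  · simp only [SDE.kL, Bool.false_eq_true, if_false, e3, cmk_bp_xor, Bool.not_false, Bool.true_and]
    cases g (jRB (v 1)) <;> cases g (jCB i) <;> cases g (jCB (i + 1)) <;> cases SDE.bp (cmkB i false g) 0 (v 1) <;>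
      cases SDE.bp (cmkF i false g) 0 (v 1) <;> cases SDE.bp (cmkB i false g) c 0 <;> simp
  · simp only [SDE.kL, if_true, e1, Bool.not_true, Bool.false_and]
    cases g (jRB (v 1)) <;> cases g (jCB i) <;> cases g (jCB (i + 1)) <;> cases SDE.bp (cmkB i true g) 0 (v 1) <;>
      cases SDE.bp (cmkB i true g) c 0 <;> simp

/-- STRIP FLAGS, face column `i`. [folklore] -/
theorem cmk_mem_Xi2_col0 {τ : Bool} (hτ : decide (i ∈ T) = τ) (g : SDE.KJ) (f : Site 2) (hf : f 0 = i) :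
    f ∈ (cmkΞ i T c g).2 ↔ (τ = true → cmkTi i τ g (f 1) = true) := by
  obtain ⟨-, -, e2, -⟩ := cmk_coreOf_Ψ i c τ g (f 1)
  rw [cmkΞ, SDE.memObsJ2_col0 i T _ f hf, hτ, SDE.flag_zero]
  cases τ
  · simp
  · simp only [if_true, forall_const]; rw [← e2]

/-- STRIP FLAGS, face column `i+1`. [folklore] -/
theorem cmk_mem_Xi2_col1 (hT : i ∈ T ↔ i + 1 ∉ T) {τ : Bool} (hτ : decide (i ∈ T) = τ) (g : SDE.KJ) (f : Site 2)
    (hf : f 0 = i + 1) : f ∈ (cmkΞ i T c g).2 ↔ (τ = false → cmkTi i τ g (f 1) = true) := by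
  obtain ⟨-, -, e2, -⟩ := cmk_coreOf_Ψ i c τ g (f 1)
  rw [cmkΞ, SDE.memObsJ2_col1 i T hT _ f hf, hτ, SDE.flag_one]
  cases τ
  · simp only [Bool.false_eq_true, if_false, forall_const]; rw [← e2]
  · simp

/-- THE ENVIRONMENT through `SDE.EE`: the erased observables of the cut-adapted configuration. [folklore] -/
theorem cmk_eraseMid_Xi (hT : i ∈ T ↔ i + 1 ∉ T) {τ : Bool} (hτ : decide (i ∈ T) = τ) (g : SDE.KJ) :
    eraseMid i (cmkΞ i T c g) = SDE.EE i T (cmkΨ i τ c g) (cmkXi g, cmkZe i τ g) := by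
  have key := SDE.eraseMid_ObsJ_off i T hT τ hτ (cmkΨ i τ c g) (cmkΨ i τ c g) (fun _ _ => rfl) (fun _ _ _ => ⟨rfl, rfl, rfl⟩)
  rw [cmkΞ, hτ, key]
  congr 1
  obtain ⟨-, -, -, -, -, ei, ei2⟩ := cmk_coreOf_Ψ i c τ g 0
  rw [ei, ei2]
  have e1 : (fun s => SDE.coreOf i τ (cmkΨ i τ c g) (1, s)) = cmkB i τ g := funext fun s => (cmk_coreOf_Ψ i c τ g s).2.1
  have e3 : (fun s => SDE.coreOf i τ (cmkΨ i τ c g) (3, s)) = fun s => cmkF i τ g s ^^ cmkB i τ g s :=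
    funext fun s => (cmk_coreOf_Ψ i c τ g s).2.2.2.1
  refine Prod.ext (funext fun y => ?_) (funext fun y => ?_)
  · obtain ⟨e0, -⟩ := cmk_coreOf_Ψ i c τ g y
    simp only [SDE.bdry, e0, cmkXi]
    cases g (jRB y) <;> cases g (jCB i) <;> rfl
  · obtain ⟨e0, -⟩ := cmk_coreOf_Ψ i c τ g y
    simp only [SDE.bdry, e0, e1, e3, cmk_bp_xor, cmkZe]
    cases g (jRB y) <;> cases g (jCB i) <;> cases g (jCB (i + 2)) <;> cases SDE.bp (cmkB i τ g) 0 y <;>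
      cases SDE.bp (cmkF i τ g) 0 y <;> rfl

end Reading

end Summit.CriticalPhenomena.CardyFormulaZ2.Theorems.IKLinearTransport.PinnedDiagramExchange
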